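/-
Origin: expansion seat `planner-pub-hodgecm-mc-axioms-1-g14-0`, handover #W101 2026-08-20T15:53:55Z md5 aae73310a573 (PKG 07c2ca36f0b4 → aae73310a573; 401 l.; MECHANICAL (iib-R) rewrite v3.1 of the PKG file as it stands (36 token edits; rules R1x2+RX[h₂]x20+RX[h₂']x14)) (`HOME/mc/pub-hodgecm-mc-axioms-1-g14/revendor/kit-r55/stage55/HodgeCM/Model/ThetaHolAssembly.lean`, md5 aae73310a573, 401 lines);
landed by the gen-22 packager (p-g22) in gate run 55 REPLACES the earlier landed copy of `HodgeCM/Model/ThetaHolAssembly.lean` (seat copy carried the packager Origin header of an earlier run (stripped)).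
-/
/-
Copyright (c) 2026. Released under Apache 2.0 license as described in the file LICENSE.
Cell pub-hodgecm, MODEL layer (construction prover mc-theta-3, gen 4), node W6b-hol (ASM) of `MODEL-DAG.md`:
the assembly of E's holomorphy binder `hol` from archimedean hypotheses on the `K`-type data.
-/
import Summits.HodgeConjecture.HodgeCM.Model.ThetaHolPin

/-!
# Holomorphy of the restricted theta forms: the assembly (W6b-hol, ASM half)

E's binder `hol` (`Model/ThetaSpaceInputPin`, `classPacksOf_pin`) asks, per good context, type index
`k ∈ {0, 1}` and `N > 0`, that the archimedean restrictions `B.toProduct.restrictedThetaForm f` of the adelic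
theta forms of the archimedean `K`-type datum `B := C V c …` be HOLOMORPHIC weight forms.  `Model/ThetaHolPin`
((AUT) half) reduces this, per weight function `f`, to real-differentiability at `b = 0` and complex-linearity
of the differential of `b ↦ Θ_f(y · ι_∞(expP b))` (`ProductKTypeData.restrictedThetaForm_mem_Hol_of_differentiableAt`).

This file ((ASM) half) discharges those two analytic conditions from THREE hypotheses, each about ONE side only:

* (H1) on the adelic side `S` — **`WeilPairData.IsThetaArchContinuous P N`** for `P := (S V c).P k`: for every
  weight function `f` and `y ∈ G_U(𝔸)` the archimedean theta functional `Φ_∞ ↦ Θ̃_{φ_N(Φ_∞)}(f)(y)`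
  (`WeilPairData.thetaArchFunₗ P N f y`, LINEAR by the kernel) is CONTINUOUS on `𝒮((J → K_∞), ℂ)` — a property
  of the pair data alone; § 2 also records the sufficient condition (W-cont) `Continuous (P.archSlotT N)`
  (the archimedean slot `Φ_∞ ↦ φ_N(Φ_∞)` is continuous into the `Θ`-initial carrier), an observation of the
  automorphic lane (autform-2 gen 6, scratch `ThetaFunctional`), `isThetaArchContinuous_of_continuous_archSlotT`;
* (AN) on the archimedean datum `B` — **`ArchKTypeData.IsWeaklyPDiff B e`**: for every continuous linear
  functional `T` of `𝒮` and every covector `ℓ`, `b ↦ T (ω_∞(e b) Φ_∞(ℓ))` is real-differentiable at `b = 0`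
  (at the pin `e = expP`, the exponentiated `𝔭`);
* (REP) on `B` — **`ArchKTypeData.IsPMinusKilled B e`**: along `t ↦ e (t v)` and `t ↦ e (t iv)` the vectors
  `ω_∞(·) Φ_∞(ℓ)` have difference-quotient limits `D`, `Dᵢ` in `𝒮` with `D + i Dᵢ = 0` — annihilation of the
  harmonic family by `𝔭₋`; or, equivalently for the assembly, its Cauchy–Riemann shape (REP′)
  **`ArchKTypeData.IsWeaklyCR B e`**: the scalarised differentials `fderiv ℝ (b ↦ T (ω_∞(e b) Φ_∞(ℓ))) 0` are
  complex-linear ((AN) + (REP) ⇒ (REP′): `isWeaklyCR_of_isPMinusKilled`).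

KERNEL chain (§ 2): `ℓ (Θ_f(y · ι_∞ g)) = Θ̃_{ω(ι_∞ g, 1) φ_N(Φ_∞(ℓ))}(f)(y)` (`thetaLiftFun_mul_right`, `s = id`)
`= Θ̃_{φ_N(ω_∞(g) Φ_∞(ℓ))}(f)(y)` ((W-⊗′) `prodN`) `= T_y (ω_∞(g) Φ_∞(ℓ))` (`ArchKTypeData.apply_thetaFormOf_mul_ιinf`);
so with (H1) `T_y` is a CLM, (AN) gives `hd`, and (§ 1, pure calculus) the derivative along `t ↦ t v` through
`T_y` is `T_y D_v` by (REP)'s slopes, whence `fderiv (iv) = T_y Dᵢ = T_y (i D) = i · fderiv (v)` — `hlin`;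
the `ℂ²`-valued function is handled componentwise (`differentiableAt_pi`, `fderiv_pi`).

Main results: `ArchKTypeData.differentiableAt_apply_thetaFormOf` (generic `X`, per covector),
**`ArchKTypeData.hol_of_isPMinusKilled`** / `ArchKTypeData.hol_of_isWeaklyCR` (E's `hol` at the pin, per
`(V, c, k, N)`), and the END-STATE corollary **`classPacksOf_pin_of_isPMinusKilled`** = `classPacksOf_pin` with
its binder `hol` replaced by `(hT) (hd) (hk)` — (H1) on `S`, (AN) and (REP) on `C`.

Nothing is cited and nothing is minted: kernel lemmas over the installed definitions; the three hypotheses are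
explicit binders on the DATA `S`, `C`.
-/

set_option autoImplicit false

noncomputable section

open Filter Topology
open scoped Classical SchwartzMap
open MulAction NumberField.mixedEmbedding
open Literature.Geometry.ComplexHyperbolic.BallModel (U21 Ball x₀)
open Literature.NumberTheory.Automorphic Literature.NumberTheory.Weil1964
open Literature.NumberTheory.Automorphic.WeightForms (ClassMapDatum thetaClasses restrictHom IsLevelCorrected
  IsWeightMatched)
open Literature.AlgebraicGeometry.HodgeTheory
open Literature.AlgebraicGeometry.ShimuraVarieties
open Literature.NumberTheory.Automorphic.PicardCM
open HodgeCM.PerL34.Seesaw HodgeCM.PerL34.RationalCoset HodgeCM.PerL34.SupplyAdelic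
open HodgeCM.Model.SupplyInstance HodgeCM.Model.SupplyResidual
open HodgeCM.Model.ThetaSpace

namespace HodgeCM
namespace Model

/-! ### § 1. Calculus: directional derivatives through a continuous linear functional -/

namespace ThetaHolAssembly

section Calculus

variable {M : Type*} [AddCommGroup M] [Module ℂ M] [Module ℝ M] [IsScalarTower ℝ ℂ M] [TopologicalSpace M]
variable {E : Type*} [NormedAddCommGroup E] [NormedSpace ℝ E]

/-- A difference-quotient limit `t⁻¹ (u t - u 0) → G` in `M` gives, through a continuous `ℂ`-linear functional
`T`, the derivative `T G` of `t ↦ T (u t)` at `0`. -/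
theorem hasDerivAt_apply_of_tendsto_slope (T : M →L[ℂ] ℂ) {u : ℝ → M} {G : M}
    (hs : Tendsto (fun t : ℝ => t⁻¹ • (u t - u 0)) (𝓝[≠] 0) (𝓝 G)) :
    HasDerivAt (fun t => T (u t)) (T G) 0 := by
  rw [hasDerivAt_iff_tendsto_slope]
  refine ((T.continuous.tendsto G).comp hs).congr fun t => ?_
  simp only [Function.comp_apply, slope_def_module, sub_zero]
  rw [ContinuousLinearMap.map_smul_of_tower, map_sub]

/-- The derivative of a Fréchet-differentiable `F` along the line `t ↦ t • v` is `fderiv F 0 v`. -/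
theorem hasDerivAt_comp_smul {W' : Type*} [NormedAddCommGroup W'] [NormedSpace ℝ W'] {F : E → W'}
    (hF : DifferentiableAt ℝ F 0) (v : E) :
    HasDerivAt (fun t : ℝ => F (t • v)) (fderiv ℝ F 0 v) 0 := by
  have hl : HasDerivAt (fun t : ℝ => t • v) ((1 : ℝ) • v) 0 := (hasDerivAt_id' (0 : ℝ)).smul_const v
  rw [one_smul] at hl
  exact hF.hasFDerivAt.comp_hasDerivAt_of_eq (0 : ℝ) hl (zero_smul ℝ v).symm

variable [Module ℂ E]

/-- **Complex-linearity of the differential from `𝔭₋`-annihilation.**  If `b ↦ T (Ψ b)` is real-differentiable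
at `0` and along `t v`, `t (iv)` the difference quotients of `Ψ` converge in `M` to `D`, `Dᵢ` with
`D + i Dᵢ = 0`, then `fderiv (T ∘ Ψ) 0 (iv) = i · fderiv (T ∘ Ψ) 0 v`. -/
theorem fderiv_I_smul_of_slopes (T : M →L[ℂ] ℂ) {Ψ : E → M} (hd : DifferentiableAt ℝ (fun b => T (Ψ b)) 0)
    (v : E) {D Dᵢ : M}
    (hD : Tendsto (fun t : ℝ => t⁻¹ • (Ψ (t • v) - Ψ 0)) (𝓝[≠] 0) (𝓝 D))
    (hDᵢ : Tendsto (fun t : ℝ => t⁻¹ • (Ψ (t • (Complex.I • v)) - Ψ 0)) (𝓝[≠] 0) (𝓝 Dᵢ))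
    (hsum : D + Complex.I • Dᵢ = 0) :
    fderiv ℝ (fun b => T (Ψ b)) 0 (Complex.I • v) = Complex.I • fderiv ℝ (fun b => T (Ψ b)) 0 v := by
  have h1 : fderiv ℝ (fun b => T (Ψ b)) 0 v = T D :=
    (hasDerivAt_comp_smul hd v).unique
      (hasDerivAt_apply_of_tendsto_slope T (u := fun t => Ψ (t • v)) (by simpa only [zero_smul] using hD))
  have h2 : fderiv ℝ (fun b => T (Ψ b)) 0 (Complex.I • v) = T Dᵢ :=
    (hasDerivAt_comp_smul hd (Complex.I • v)).unique
      (hasDerivAt_apply_of_tendsto_slope T (u := fun t => Ψ (t • (Complex.I • v)))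
        (by simpa only [zero_smul] using hDᵢ))
  have h3 : Dᵢ = Complex.I • D := by
    have h := congrArg (fun x : M => Complex.I • x) hsum
    simp only [smul_add, smul_smul, Complex.I_mul_I, neg_smul, one_smul, smul_zero] at h
    rw [← sub_eq_add_neg, sub_eq_zero] at h
    exact h.symm
  rw [h2, h1, h3, map_smul]

/-- Componentwise version for a `ℂ^ι`-valued function. -/
theorem differentiableAt_and_fderiv_I_smul_pi {ι' : Type*} [Fintype ι'] {Fv : E → ι' → ℂ}
    (hd : ∀ j, DifferentiableAt ℝ (fun b => Fv b j) 0)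
    (hlin : ∀ j (v : E), fderiv ℝ (fun b => Fv b j) 0 (Complex.I • v) =
      Complex.I • fderiv ℝ (fun b => Fv b j) 0 v) :
    DifferentiableAt ℝ Fv 0 ∧
      ∀ v : E, fderiv ℝ Fv 0 (Complex.I • v) = Complex.I • fderiv ℝ Fv 0 v := by
  refine ⟨differentiableAt_pi.2 hd, fun v => ?_⟩
  have h : fderiv ℝ Fv 0 = ContinuousLinearMap.pi fun j => fderiv ℝ (fun b => Fv b j) 0 :=
    fderiv_pi (φ := fun j b => Fv b j) hd
  rw [h]
  ext j
  simp only [ContinuousLinearMap.pi_apply, Pi.smul_apply, hlin]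

end Calculus

end ThetaHolAssembly

/-! ### § 2. The archimedean theta functional of a pair and the kernel chain -/

namespace SupplyResidual.WeilPairData

variable {K L : Type} [Field K] [NumberField K] [Field L] [NumberField L] [Algebra K L] [FiniteDimensional K L]
variable {J : Type} [Fintype J] {GU : Type} [Group GU] [TopologicalSpace GU] (P : WeilPairData K L J GU)
/-- **The archimedean slot at the level `N`**: `Φ_∞ ↦ φ_N(Φ_∞) = Φ_∞ ⊗ 1_{x₀ + N𝒪̂^J}` (`testFunₗ`) read INTO
THE `Θ`-INITIAL CARRIER `ThetaTop` of the pair's Weil datum (so that `Continuous (P.archSlotT N)` refers to the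
`Θ`-initial topology). -/
def archSlotT (N : ℕ) : 𝓢((J → mixedSpace K), ℂ) →ₗ[ℂ] P.weilDatum.ThetaTop := testFunₗ K J P.x₀ N

/-- (Ported verbatim from the HodgeCMPerL package; no docstring in the source.) -/
@[simp] theorem archSlotT_apply (N : ℕ) (Φinf : 𝓢((J → mixedSpace K), ℂ)) :
    P.archSlotT N Φinf = P.weilDatum.toThetaTop (testFun K J Φinf P.x₀ N) := rfl

variable [IsTopologicalGroup GU] [LocallyCompactSpace GU] [CompactSpace (GU ⧸ P.ΓU)]

/-- **The archimedean theta functional** `Φ_∞ ↦ Θ̃_{φ_N(Φ_∞)}(f)(y)` of the pair data `P` at the level `N`, the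
weight function `f` and the point `y ∈ G_U(𝔸)` — `ℂ`-LINEAR (kernel: `thetaLiftFunₗ ∘ archSlotT`, evaluated
at `y`). -/
def thetaArchFunₗ (N : ℕ) (f : C(relNormOneIdeles K L ⧸ relNormOneRat K L, ℂ)) (y : GU) :
    𝓢((J → mixedSpace K), ℂ) →ₗ[ℂ] ℂ :=
  (LinearMap.proj y : (GU → ℂ) →ₗ[ℂ] ℂ) ∘ₗ
    P.kernelDatum.thetaLiftFunₗ (probHaarRelNormOneQuot K L) P.kernelDatum_thetaLinear f ∘ₗ P.archSlotT N

/-- (Ported verbatim from the HodgeCMPerL package; no docstring in the source.) -/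
@[simp] theorem thetaArchFunₗ_apply (N : ℕ) (f : C(relNormOneIdeles K L ⧸ relNormOneRat K L, ℂ)) (y : GU)
    (Φinf : 𝓢((J → mixedSpace K), ℂ)) :
    P.thetaArchFunₗ N f y Φinf =
      P.kernelDatum.thetaLiftFun (probHaarRelNormOneQuot K L) (P.weilDatum.toThetaTop (testFun K J Φinf P.x₀ N))
        f y :=
  rfl

/-- **(H1)** the archimedean theta functionals of `P` at the test functions `φ_N` are CONTINUOUS on
`𝒮((J → K_∞), ℂ)`, for every weight function `f` and every `y ∈ G_U(𝔸)` — a property of the pair data ALONE. -/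
def IsThetaArchContinuous (N : ℕ) : Prop :=
  ∀ (f : C(relNormOneIdeles K L ⧸ relNormOneRat K L, ℂ)) (y : GU), Continuous (P.thetaArchFunₗ N f y)

/-- **(W-cont) ⇒ (H1)**: if the archimedean slot `Φ_∞ ↦ φ_N(Φ_∞)` is continuous INTO THE `Θ`-INITIAL
TOPOLOGY of `𝒮(𝔸_K^J)`, the theta functionals are continuous (the theta lift is continuous on the `Θ`-initial
carrier: `ThetaKernelDatum.continuous_thetaLift_left`; observation of the automorphic lane, autform-2 gen 6). -/
theorem isThetaArchContinuous_of_continuous_archSlotT (N : ℕ) (h : Continuous (P.archSlotT N)) :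
    P.IsThetaArchContinuous N := fun f y =>
  ((continuous_eval_const (QuotientGroup.mk y⁻¹ : GU ⧸ P.ΓU)).comp
    (P.kernelDatum.continuous_thetaLift_left (probHaarRelNormOneQuot K L) f)).comp h

/-- Under (H1), the archimedean theta functional as a continuous linear functional. -/
def thetaArchCLM {N : ℕ} (hT : P.IsThetaArchContinuous N) (f : C(relNormOneIdeles K L ⧸ relNormOneRat K L, ℂ))
    (y : GU) : 𝓢((J → mixedSpace K), ℂ) →L[ℂ] ℂ :=
  ⟨P.thetaArchFunₗ N f y, hT f y⟩

/-- (Ported verbatim from the HodgeCMPerL package; no docstring in the source.) -/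
@[simp] theorem thetaArchCLM_apply {N : ℕ} (hT : P.IsThetaArchContinuous N)
    (f : C(relNormOneIdeles K L ⧸ relNormOneRat K L, ℂ)) (y : GU) (Φinf : 𝓢((J → mixedSpace K), ℂ)) :
    P.thetaArchCLM hT f y Φinf = P.thetaArchFunₗ N f y Φinf :=
  rfl

end SupplyResidual.WeilPairData

section ArchFunctional

variable {U : Universe} {Lc : CMField} {ι₁ : Lc →+* ℂ} {V : HermSpace3 Lc ι₁} {c : SeesawCtx Lc}

namespace ArchKTypeData

variable {X : ThetaSpaceInput U V c} {k : Fin 4} {N : ℕ} (B : ArchKTypeData X k N)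

/-- The product structure on the `Θ`-initial carrier: `ω(ι_∞ g, 1) φ_N(Φ_∞(ℓ)) = φ_N(ω_∞(g) Φ_∞(ℓ))`
((W-⊗′) `prodN`, with `s = id`). -/
theorem act_jFam (g : X.G₁) (ℓ : Module.Dual ℂ X.W) :
    (X.P k).kernelDatum.W.act ((X.P k).kernelDatum.s (X.ιinf B.Γ₀ g, 1)) (B.toProduct.jFam ℓ) =
      (X.P k).weilDatum.toThetaTop (testFun X.K X.J (B.ωinf g (B.Φarch ℓ)) (X.P k).x₀ N) := by
  change (X.P k).ω (X.ιinf B.Γ₀ g, 1) (testFun X.K X.J (B.Φarch ℓ) (X.P k).x₀ N) = _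
  exact B.prodN g (B.Φarch ℓ)

/-- **KERNEL CHAIN**: the `ℓ`-component of the theta form of the one family at `y · ι_∞(g)` is the
archimedean theta functional at `y` of `ω_∞(g) Φ_∞(ℓ)`. -/
theorem apply_thetaFormOf_mul_ιinf (f : C(relNormOneIdeles X.K X.L ⧸ relNormOneRat X.K X.L, ℂ)) (y : X.GU)
    (g : X.G₁) (ℓ : Module.Dual ℂ X.W) :
    ℓ ((B.toProduct.thetaFormOf f).1 (y * X.ιinf B.Γ₀ g)) =
      (X.P k).thetaArchFunₗ N f y (B.ωinf g (B.Φarch ℓ)) := by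
  rw [WeilPairData.thetaArchFunₗ_apply, ← B.act_jFam g ℓ, ← ThetaKernelDatum.thetaLiftFun_mul_right]
  exact (X.P k).kernelDatum.apply_thetaForm _ _ _ _ _ _ _ f (y * X.ιinf B.Γ₀ g) ℓ

/-- **(AN)** weak real-differentiability at `0` of `b ↦ ω_∞(e b) Φ_∞(ℓ)` through every continuous linear
functional of `𝒮((J → K_∞), ℂ)` (`e` = the exponential chart of `𝔭`, `expP` at the pin). -/
def IsWeaklyPDiff {P' : Type*} [NormedAddCommGroup P'] [NormedSpace ℝ P'] (e : P' → X.G₁) : Prop :=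
  ∀ (T : 𝓢((X.J → mixedSpace X.K), ℂ) →L[ℂ] ℂ) (ℓ : Module.Dual ℂ X.W),
    DifferentiableAt ℝ (fun b => T (B.ωinf (e b) (B.Φarch ℓ))) 0

/-- **(REP)** annihilation of the harmonic family by `𝔭₋`: along `t ↦ e (t v)` and `t ↦ e (t iv)` the vectors
`ω_∞(·) Φ_∞(ℓ)` have difference-quotient limits `D`, `Dᵢ` in `𝒮((J → K_∞), ℂ)` with `D + i Dᵢ = 0`. -/
def IsPMinusKilled {P' : Type*} [NormedAddCommGroup P'] [NormedSpace ℝ P'] [Module ℂ P'] (e : P' → X.G₁) :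
    Prop :=
  ∀ (v : P') (ℓ : Module.Dual ℂ X.W), ∃ D Dᵢ : 𝓢((X.J → mixedSpace X.K), ℂ),
    Tendsto (fun t : ℝ => t⁻¹ • (B.ωinf (e (t • v)) (B.Φarch ℓ) - B.Φarch ℓ)) (𝓝[≠] 0) (𝓝 D) ∧
    Tendsto (fun t : ℝ => t⁻¹ • (B.ωinf (e (t • (Complex.I • v))) (B.Φarch ℓ) - B.Φarch ℓ)) (𝓝[≠] 0)
      (𝓝 Dᵢ) ∧
    D + Complex.I • Dᵢ = 0

/-- **(REP′)** the Cauchy–Riemann shape of (REP): through every continuous linear functional `T` of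
`𝒮((J → K_∞), ℂ)`, the differential at `0` of `b ↦ T (ω_∞(e b) Φ_∞(ℓ))` is complex-linear (the shape delivered
by a scalar Cauchy–Riemann computation; implied by (AN) + (REP), `isWeaklyCR_of_isPMinusKilled`). -/
def IsWeaklyCR {P' : Type*} [NormedAddCommGroup P'] [NormedSpace ℝ P'] [Module ℂ P'] (e : P' → X.G₁) : Prop :=
  ∀ (T : 𝓢((X.J → mixedSpace X.K), ℂ) →L[ℂ] ℂ) (ℓ : Module.Dual ℂ X.W) (v : P'),
    fderiv ℝ (fun b => T (B.ωinf (e b) (B.Φarch ℓ))) 0 (Complex.I • v) =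
      Complex.I • fderiv ℝ (fun b => T (B.ωinf (e b) (B.Φarch ℓ))) 0 v

/-- **(AN) + (REP) ⇒ (REP′)** along a chart `e` with `e 0 = 1` (§ 1: the derivative along `t ↦ t v` through
`T` is `T D_v`, and `Dᵢ = i D`). -/
theorem isWeaklyCR_of_isPMinusKilled {P' : Type*} [NormedAddCommGroup P'] [NormedSpace ℝ P'] [Module ℂ P']
    {e : P' → X.G₁} (he : e 0 = 1) (hd : B.IsWeaklyPDiff e) (hk : B.IsPMinusKilled e) : B.IsWeaklyCR e := by
  intro T ℓ v
  have h0 : B.ωinf (e 0) (B.Φarch ℓ) = B.Φarch ℓ := by rw [he, map_one, Module.End.one_apply]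
  obtain ⟨D, Dᵢ, hD, hDᵢ, hsum⟩ := hk v ℓ
  exact ThetaHolAssembly.fderiv_I_smul_of_slopes T (Ψ := fun b => B.ωinf (e b) (B.Φarch ℓ)) (hd T ℓ) v
    (by simpa only [h0] using hD) (by simpa only [h0] using hDᵢ) hsum

/-- **(H1) + (AN) + (REP′) ⇒ `hd` and `hlin` per covector** (generic theta-space input): the `ℓ`-component of
`b ↦ Θ_f(y · ι_∞(e b))` is real-differentiable at `0` with complex-linear differential. -/
theorem differentiableAt_apply_thetaFormOf {P' : Type*} [NormedAddCommGroup P'] [NormedSpace ℝ P']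
    [Module ℂ P'] (e : P' → X.G₁) (hT : (X.P k).IsThetaArchContinuous N) (hd : B.IsWeaklyPDiff e)
    (hCR : B.IsWeaklyCR e) (f : C(relNormOneIdeles X.K X.L ⧸ relNormOneRat X.K X.L, ℂ)) (y : X.GU)
    (ℓ : Module.Dual ℂ X.W) :
    DifferentiableAt ℝ (fun b => ℓ ((B.toProduct.thetaFormOf f).1 (y * X.ιinf B.Γ₀ (e b)))) 0 ∧
      ∀ v : P',
        fderiv ℝ (fun b => ℓ ((B.toProduct.thetaFormOf f).1 (y * X.ιinf B.Γ₀ (e b)))) 0 (Complex.I • v) =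
          Complex.I • fderiv ℝ (fun b => ℓ ((B.toProduct.thetaFormOf f).1 (y * X.ιinf B.Γ₀ (e b)))) 0 v := by
  have hfun : (fun b => ℓ ((B.toProduct.thetaFormOf f).1 (y * X.ιinf B.Γ₀ (e b)))) =
      fun b => (X.P k).thetaArchCLM hT f y (B.ωinf (e b) (B.Φarch ℓ)) :=
    funext fun b => B.apply_thetaFormOf_mul_ιinf f y (e b) ℓ
  rw [hfun]
  exact ⟨hd _ ℓ, hCR _ ℓ⟩

end ArchKTypeData

end ArchFunctional

/-! ### § 3. At the pin: E's `hol` from (H1) + (AN) + (REP) -/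

section PinHol

variable (hHD : exists_isReal_hodgeModel) (hI : hodgePQ_independent_of_hodgeModel)
  (h₁ : BallQuotientUniformised)  (h₃ : CMAbelianVarietyRealised)

variable {L : CMField} {ι₁ : L →+* ℂ} {V : HermSpace3 L ι₁} {c : SeesawCtx L}

/-- **E's `hol` at the pin, per `(V, c, k, N)` — Cauchy–Riemann shape** (node W6b-hol, (ASM)): for an
archimedean `K`-type datum `B` over the pinned theta-space input, (H1) continuity of the archimedean theta
functionals of `S.P k`, (AN) weak differentiability of the boost orbits of the harmonic family and (REP′) the
complex-linearity of their scalarised differentials give holomorphy of every restricted theta form. -/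
theorem ArchKTypeData.hol_of_isWeaklyCR (S : ThetaAdelicSide V c) (h : IsAnisotropic L V.Hm)
    {k : Fin 4} {N : ℕ} (B : ArchKTypeData (thetaSpaceInputIn hHD hI h₁ h₃ S h) k N)
    (hT : ((thetaSpaceInputIn hHD hI h₁ h₃ S h).P k).IsThetaArchContinuous N)
    (hd : B.IsWeaklyPDiff BallForms.expP) (hCR : B.IsWeaklyCR BallForms.expP) :
    ∀ f ∈ ((thetaSpaceInputIn hHD hI h₁ h₃ S h).P k).weightFunctions,
      B.toProduct.restrictedThetaForm f ∈ ((thetaSpaceInputIn hHD hI h₁ h₃ S h).D B.Γ₀).Hol := by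
  intro f _
  have key : ∀ y : (thetaSpaceInputIn hHD hI h₁ h₃ S h).GU,
      DifferentiableAt ℝ
          (fun b : Fin 2 → ℂ =>
            B.toProduct.thetaFunIn f
              (y * (thetaSpaceInputIn hHD hI h₁ h₃ S h).ιinf B.toProduct.Γ₀ (BallForms.expP b))) 0 ∧
        ∀ v : Fin 2 → ℂ,
          fderiv ℝ
              (fun b : Fin 2 → ℂ =>
                B.toProduct.thetaFunIn f
                  (y * (thetaSpaceInputIn hHD hI h₁ h₃ S h).ιinf B.toProduct.Γ₀ (BallForms.expP b))) 0
              (Complex.I • v) =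
            Complex.I •
              fderiv ℝ
                (fun b : Fin 2 → ℂ =>
                  B.toProduct.thetaFunIn f
                    (y * (thetaSpaceInputIn hHD hI h₁ h₃ S h).ιinf B.toProduct.Γ₀ (BallForms.expP b))) 0
                v := by
    intro y
    refine ThetaHolAssembly.differentiableAt_and_fderiv_I_smul_pi (fun j => ?_) (fun j v => ?_)
    · exact (B.differentiableAt_apply_thetaFormOf BallForms.expP hT hd hCR f y (LinearMap.proj j)).1
    · exact (B.differentiableAt_apply_thetaFormOf BallForms.expP hT hd hCR f y (LinearMap.proj j)).2 v
  exact B.toProduct.restrictedThetaForm_mem_Hol_of_differentiableAt hHD hI h₁ h₃ S h f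
    (fun y => (key y).1) (fun y v => (key y).2 v)

/-- **E's `hol` at the pin, per `(V, c, k, N)` — `𝔭₋` shape** (node W6b-hol, (ASM)): for an archimedean
`K`-type datum `B` over the pinned theta-space input, (H1) continuity of the archimedean theta functionals of
`S.P k`, (AN) weak differentiability of the boost orbits of the harmonic family and (REP) their annihilation by
`𝔭₋` give holomorphy of every restricted theta form `B.toProduct.restrictedThetaForm f`, `f` a weight function. -/
theorem ArchKTypeData.hol_of_isPMinusKilled (S : ThetaAdelicSide V c) (h : IsAnisotropic L V.Hm)
    {k : Fin 4} {N : ℕ} (B : ArchKTypeData (thetaSpaceInputIn hHD hI h₁ h₃ S h) k N)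
    (hT : ((thetaSpaceInputIn hHD hI h₁ h₃ S h).P k).IsThetaArchContinuous N)
    (hd : B.IsWeaklyPDiff BallForms.expP) (hk : B.IsPMinusKilled BallForms.expP) :
    ∀ f ∈ ((thetaSpaceInputIn hHD hI h₁ h₃ S h).P k).weightFunctions,
      B.toProduct.restrictedThetaForm f ∈ ((thetaSpaceInputIn hHD hI h₁ h₃ S h).D B.Γ₀).Hol :=
  B.hol_of_isWeaklyCR hHD hI h₁ h₃ S h hT hd (B.isWeaklyCR_of_isPMinusKilled BallForms.expP_zero hd hk)

end PinHol

/-! ### § 4. END STATE: `classPacks` from `S`, `C` and (H1) + (AN) + (REP) -/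

section EndState

variable (hHD : exists_isReal_hodgeModel) (hI : hodgePQ_independent_of_hodgeModel)
  (h₁ : BallQuotientUniformised)  (h₃ : CMAbelianVarietyRealised)


-- port_pkg: scope closed for this part
end EndState
end Model
end HodgeCM
end
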